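import Summits.QuantumAdvantage.QuantumAdvantage.Theorems.CubicForrelationNearExactIsExactTwelveTypeO960Below929
import Summits.QuantumAdvantage.QuantumAdvantage.Theorems.CubicForrelationNearExactIsExactTwelveLevelFiveHyperplaneGe2932

/-!
# Crux `CubicForrelation.NearExactIsExact` (stmt-QuantumAdvantage-14043) — n = 12, type O with base set `960` AT the boundary `Φ = 29/32`
  (excess `512`, `Σ v² ≤ 32`): the partner is at level `≥ 6` (type-O and level-5 partners are DEAD), and the wild function is `32` aligned
  points (`Σ v² = 32`, `v̂ ∈ {0, ±32}`, `v̂ ≠ 0` on exactly `128` characters)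

Certificate seat `b2b-cforr-cert` (gen 22).  HONEST FRAMING: a kernel-checked DICHOTOMY (standard axioms, no `decide`) about cubic Boolean pairs
on 12 bits — the base-`960` configuration of the boundary rung `29/32 = 928/1024` (HOME/b2b-cforr-cert-g20/PLAN-N12-928.md) is reduced to ONE
rigid wild-function shape with a partner at level `≥ 6`; that last sub-case (which needs the parity structure of the character sums `Ê(z)/64`
of the weight-`960` cubic support — a 9-dimensional subspace) is NOT killed here.  NO new value of `θ₁₂`.  NOT summit progress.

* `to22_wild_engine32_dichotomy`: the engine `to22_wild_engine31` one step further: `Σ v² ≤ 32`, `v̂ = 8k`, `4 ∣ k + u_f` ⇒ `v ≡ 0`, or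
  `4 ∣ u_f` everywhere with `Σ v² = 32`, `k ∈ {0, ±4}`, `#{k ≠ 0} = 128`.
* `to22_typeO_E960_ge2932_dichotomy`: type O (`W_g = 16u`, some `u` odd), `#E = 960`, `Φ ≥ 29/32` ⇒ `Φ = 29/32` and the second alternative
  holds for the partner `f` (`W_f = 16u_f`) and the wild function `v` of `u − 4(−1)^f = τ₀ + 8v` (at `Φ ≥ 930/1024` by
  `to19_typeO_E960_ge930_false'`; the budget `Σ τ² ≤ 12288` gives `Σ v² ≤ 32`; the partner identity and `to18_char_sum_E960` give `v̂ = 8k`,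
  `4 ∣ k + u_f`; the hyperplane count is `tw22_oddset_card_ge2932`; `v ≡ 0` would mean `Φ = 932/1024`).
* `to22_typeO_E960_typeO_partner_false`, `to22_typeO_E960_levelFive_partner_false`: NO type-O × type-O and NO type-O × level-5 pair with a
  type-O base set of `960` points at `Φ ≥ 29/32`.

References: Kasami–Tokura (1970); MacWilliams–Sloane (1977) Ch. 14–15; Carlet (2021) §5.2; O'Donnell (2014) §1.4, §3.3.  Axioms: the standard three.
-/

set_option linter.dupNamespace false -- D-0017: single-problem summit ⇒ `QuantumAdvantage.QuantumAdvantage` by design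

noncomputable section

namespace Summit.QuantumAdvantage.QuantumAdvantage.Theorems.CubicForrelation.NearExactIsExact

open Finset
open Literature.Computability.QuantumComplexity
open Literature.Computability.QuantumComplexity.BuzetChailloux (bxor zeroVec bxor_bxor_cancel_left bxor_zeroVec zeroVec_bxor bxor_comm
  bxor_self twist_zeroVec_right twist_bxor_right)
open Literature.Computability.QuantumComplexity.DerivativeWalsh (W sum_W_sq)
open Literature.Computability.QuantumComplexity.Simon (twist_eq_one_or)
open Summit.QuantumAdvantage.QuantumAdvantage.Theorems.NearExactIsExact.Negative (TypeOTwelve.typeO_of_exists_odd)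

/-! ### The wild-function engine at `Σ v² ≤ 32`: a dichotomy -/

/-- **Wild-function engine at `Σ v² ≤ 32`, dichotomy form.**  `f` cubic on 12 bits with `W_f = 16·u_f`; the level-5 hyperplane count of `f`
as a hypothesis (`u_f` even everywhere and `u_f/2` odd somewhere ⇒ at least `2048` points with `u_f/2` odd); an integer function `v` with
`Σ v² ≤ 32` whose transform satisfies `v̂(y) = 8k(y)` with `4 ∣ k(y) + u_f(y)`: either `v ≡ 0`, or `4 ∣ u_f` everywhere (the partner is at level
`≥ 6`), `Σ v² = 32`, every `k(y) ∈ {0, ±4}` and exactly `128` of them are non-zero.  (`|v̂| ≤ Σ|v| ≤ 32` gives `|k| ≤ 4`; `u_f` odd ⇒ all `k`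
odd ⇒ `Σ k² ≥ 4096 > 64·32`; `u_f/2` odd on `≥ 2048` points ⇒ `Σ k² ≥ 8192`; so `4 ∣ u_f`, `4 ∣ k`; `k ≢ 0` ⇒ some `|v̂| = 32` ⇒ `Σ v² = 32`
⇒ `Σ k² = 2048 = 16·#{k ≠ 0}`.) [this work] -/
theorem to22_wild_engine32_dichotomy (f : (Fin (6 + 6) → Bool) → Bool) (hf : IsDegLeFun 3 f)
    (uf : (Fin (6 + 6) → Bool) → ℤ) (huf : ∀ y, W (fun x => signOf (f x)) y = (2 : ℝ) ^ 4 * (uf y : ℝ))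
    (hS : (∀ y, ¬ Odd (uf y)) → (∃ y, Odd (uf y / 2)) → 2048 ≤ #(univ.filter fun y : Fin (6 + 6) → Bool => Odd (uf y / 2)))
    (v : (Fin (6 + 6) → Bool) → ℤ) (hV : ∑ x, v x ^ 2 ≤ 32)
    (k : (Fin (6 + 6) → Bool) → ℤ) (hk : ∀ y, ∑ x, (v x : ℝ) * twist x y = 8 * (k y : ℝ)) (hk4 : ∀ y, (4 : ℤ) ∣ k y + uf y) :
    (∀ x, v x = 0) ∨
    ((∀ y, ¬ Odd (uf y)) ∧ (∀ y, ¬ Odd (uf y / 2)) ∧ ∑ x, v x ^ 2 = 32 ∧ (∀ y, k y = 0 ∨ k y = 4 ∨ k y = -4) ∧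
      #(univ.filter fun y : Fin (6 + 6) → Bool => k y ≠ 0) = 128) := by
  classical
  have hpars : ∑ y, (∑ x, (v x : ℝ) * twist x y) ^ 2 = 4096 * ∑ x, ((v x : ℝ)) ^ 2 := by
    have h := sum_W_sq (n := 6 + 6) (fun x => (v x : ℝ))
    unfold W at h
    rw [h]; norm_num
  have hV' : ∑ x, ((v x : ℝ)) ^ 2 ≤ 32 := by
    have : ((∑ x, v x ^ 2 : ℤ) : ℝ) ≤ 32 := by exact_mod_cast hV
    push_cast at this; exact this
  have hk2eq : ∑ y, ((k y : ℝ)) ^ 2 = 64 * ∑ x, ((v x : ℝ)) ^ 2 := by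
    have e : ∑ y, (∑ x, (v x : ℝ) * twist x y) ^ 2 = 64 * ∑ y, ((k y : ℝ)) ^ 2 := by
      rw [mul_sum]; exact sum_congr rfl fun y _ => by rw [hk y]; ring
    rw [e] at hpars
    linarith
  have hk2sum : ∑ y, ((k y : ℝ)) ^ 2 ≤ 2048 := by rw [hk2eq]; linarith
  -- `|v̂(y)| ≤ Σ|v| ≤ Σ v²`
  have hvhat_le : ∀ y, |∑ x, (v x : ℝ) * twist x y| ≤ ∑ x, ((v x : ℝ)) ^ 2 := by
    intro y
    calc |∑ x, (v x : ℝ) * twist x y| ≤ ∑ x, |(v x : ℝ) * twist x y| := abs_sum_le_sum_abs _ _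
      _ = ∑ x, |(v x : ℝ)| := sum_congr rfl fun x _ => by
          rw [abs_mul]; rcases twist_eq_one_or x y with h | h <;> rw [h] <;> simp
      _ ≤ ∑ x, ((v x : ℝ)) ^ 2 := sum_le_sum fun x _ => by
          rw [← Int.cast_abs]
          have habs : |v x| ≤ v x ^ 2 := by
            rcases le_or_gt 0 (v x) with h | h
            · rw [abs_of_nonneg h]; nlinarith
            · rw [abs_of_neg h]; nlinarith
          exact_mod_cast habs
  have hkabs : ∀ y, |k y| ≤ 4 := by
    intro y
    have h1 : |∑ x, (v x : ℝ) * twist x y| ≤ 32 := (hvhat_le y).trans hV'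
    rw [hk y, abs_mul, abs_of_nonneg (by norm_num : (0:ℝ) ≤ 8)] at h1
    have h2 : ((8 * |k y| : ℤ) : ℝ) ≤ 32 := by push_cast; exact h1
    have h3 : (8 * |k y| : ℤ) ≤ 32 := by exact_mod_cast h2
    omega
  -- a set of `N` points with `k² ≥ c` costs `c·N ≤ 2048`
  have hbig : ∀ (S : Finset (Fin (6 + 6) → Bool)) (c : ℝ), 0 ≤ c → (∀ y ∈ S, c ≤ ((k y : ℝ)) ^ 2) → c * #S ≤ 2048 := by
    intro S c hc hS'
    have h1 : ∑ y ∈ S, c ≤ ∑ y ∈ S, ((k y : ℝ)) ^ 2 := sum_le_sum hS'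
    rw [sum_const, nsmul_eq_mul, mul_comm] at h1
    have h2 : ∑ y ∈ S, ((k y : ℝ)) ^ 2 ≤ ∑ y, ((k y : ℝ)) ^ 2 :=
      sum_le_sum_of_subset_of_nonneg (subset_univ S) fun y _ _ => sq_nonneg _
    linarith
  by_cases hO : ∃ y, Odd (uf y)
  · -- all `u_f` odd, so all `k` odd: `k² ≥ 1` at `4096` points
    exfalso
    obtain ⟨y₁, hy₁⟩ := hO
    have hdeg := stub_walshTower stub_axParity (6 + 6) 4 0 f uf hf huf (by intro j hj hjn; omega)
    have hallodd : ∀ y, Odd (uf y) := by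
      intro y
      have h := tc_const_of_deg_zero hdeg y y₁
      have h1 : decide (Odd (uf y₁)) = true := by simpa using hy₁
      rw [h1] at h
      simpa using h
    have hk1 : ∀ y ∈ (univ : Finset (Fin (6 + 6) → Bool)), (1 : ℝ) ≤ ((k y : ℝ)) ^ 2 := by
      intro y _
      obtain ⟨j, hj⟩ := hk4 y
      have h0 := Int.odd_iff.1 (hallodd y)
      have : k y ≤ -1 ∨ 1 ≤ k y := by omega
      have hsq := tp_sq_ge (k := 1) (by norm_num) this
      exact_mod_cast hsq
    have := hbig univ 1 (by norm_num) hk1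
    rw [card_univ, Fintype.card_fun, Fintype.card_bool, Fintype.card_fin] at this
    norm_num at this
  push Not at hO
  have hev2 : ∀ y, uf y = 2 * (uf y / 2) := fun y =>
    (Int.mul_ediv_cancel' (even_iff_two_dvd.1 (Int.not_odd_iff_even.1 (hO y)))).symm
  by_cases hO5 : ∃ y, Odd (uf y / 2)
  · -- the odd set of `u_f/2` has `≥ 2048` points and carries `|k| ≥ 2`
    exfalso
    have hcard := hS hO hO5
    have h4 : ∀ y ∈ univ.filter (fun y : Fin (6 + 6) → Bool => Odd (uf y / 2)), (4 : ℝ) ≤ ((k y : ℝ)) ^ 2 := by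
      intro y hy
      have hyo : Odd (uf y / 2) := (mem_filter.1 hy).2
      obtain ⟨j, hj⟩ := hk4 y
      have h0 := Int.odd_iff.1 hyo
      have h2 := hev2 y
      have : k y ≤ -2 ∨ 2 ≤ k y := by omega
      have hsq := tp_sq_ge (k := 2) (by norm_num) this
      have : (4 : ℤ) ≤ k y ^ 2 := by linarith
      exact_mod_cast this
    have h := hbig _ 4 (by norm_num) h4
    have hc : (2048 : ℝ) ≤ (#(univ.filter fun y : Fin (6 + 6) → Bool => Odd (uf y / 2)) : ℝ) := by exact_mod_cast hcard
    linarith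
  push Not at hO5
  -- `4 ∣ u_f`, so `4 ∣ k`, `|k| ≤ 4`
  have hkval : ∀ y, k y = 0 ∨ k y = 4 ∨ k y = -4 := by
    intro y
    obtain ⟨j, hj⟩ := hk4 y
    have h2 := hev2 y
    have h4 : uf y / 2 = 2 * (uf y / 2 / 2) :=
      (Int.mul_ediv_cancel' (even_iff_two_dvd.1 (Int.not_odd_iff_even.1 (hO5 y)))).symm
    have hk3 := hkabs y
    rw [abs_le] at hk3
    omega
  by_cases hk0 : ∀ y, k y = 0
  · left
    have hvhat0 : ∑ y, (∑ x, (v x : ℝ) * twist x y) ^ 2 = 0 :=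
      sum_eq_zero fun y _ => by rw [hk y, hk0 y]; norm_num
    rw [hpars] at hvhat0
    have hsum0 : ∑ x, ((v x : ℝ)) ^ 2 = 0 := by linarith
    intro x
    have := (sum_eq_zero_iff_of_nonneg fun z _ => sq_nonneg ((v z : ℝ))).1 hsum0 x (mem_univ x)
    exact_mod_cast pow_eq_zero_iff two_ne_zero |>.1 this
  · right
    push Not at hk0
    obtain ⟨y₀, hy₀⟩ := hk0
    -- `|v̂(y₀)| = 32` forces `Σ v² = 32`
    have h32 : (32 : ℝ) ≤ ∑ x, ((v x : ℝ)) ^ 2 := by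
      have h1 := hvhat_le y₀
      rw [hk y₀, abs_mul, abs_of_nonneg (by norm_num : (0:ℝ) ≤ 8)] at h1
      have hk4' : (4 : ℝ) ≤ |(k y₀ : ℝ)| := by
        rw [← Int.cast_abs]
        have : (4 : ℤ) ≤ |k y₀| := by
          rcases hkval y₀ with h | h | h
          · exact absurd h hy₀
          · rw [h]; norm_num
          · rw [h]; norm_num
        exact_mod_cast this
      linarith
    have hVeq : ∑ x, v x ^ 2 = 32 := by
      have : (32 : ℝ) ≤ ((∑ x, v x ^ 2 : ℤ) : ℝ) := by push_cast; exact h32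
      have : (32 : ℤ) ≤ ∑ x, v x ^ 2 := by exact_mod_cast this
      exact le_antisymm hV this
    refine ⟨hO, hO5, hVeq, hkval, ?_⟩
    -- `Σ k² = 2048` with `k² ∈ {0, 16}`
    have hk2val : ∑ y, ((k y : ℝ)) ^ 2 = 2048 := by
      rw [hk2eq]
      have : ((∑ x, v x ^ 2 : ℤ) : ℝ) = 32 := by exact_mod_cast hVeq
      push_cast at this
      rw [this]; norm_num
    have hsq : ∀ y, ((k y : ℝ)) ^ 2 = 16 * (if k y ≠ 0 then (1 : ℝ) else 0) := by
      intro y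
      rcases hkval y with h | h | h <;> simp [h] <;> norm_num
    rw [sum_congr rfl fun y _ => hsq y, ← mul_sum, sum_boole] at hk2val
    have h : ((#(univ.filter fun y : Fin (6 + 6) → Bool => k y ≠ 0) : ℕ) : ℝ) = 128 := by
      linarith
    exact_mod_cast h

/-! ### Base set `960` at `Φ ≥ 29/32`: the dichotomy collapses to `Φ = 29/32` with thirty-two aligned wild points -/

/-- **Type O, `#E = 960`, `Φ ≥ 29/32` on 12 bits: `Φ = 29/32`, the partner `f` is at level `≥ 6` (`4 ∣ u_f = W_f/16` everywhere), and the
wild function `v` of `u − 4(−1)^f = τ₀ + 8v` has `Σ v² = 32` with `v̂ = 8k`, `k ∈ {0, ±4}` non-zero on exactly `128` characters and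
`4 ∣ k + u_f`.**  See the module docstring.  Finite-slice statement; NOT summit progress. [this work] -/
theorem to22_typeO_E960_ge2932_dichotomy (f g : (Fin (6 + 6) → Bool) → Bool) (hf : IsDegLeFun 3 f) (hg : IsDegLeFun 3 g)
    (u : (Fin (6 + 6) → Bool) → ℤ) (hu : ∀ x, W (fun y => signOf (g y)) x = (2 : ℝ) ^ 4 * (u x : ℝ))
    (hodd : ∃ x, Odd (u x)) (hE : #(univ.filter fun x : Fin (6 + 6) → Bool => (Odd (u x / 2) ↔ Odd (u x / 2 / 2))) = 960)
    (hΦ : (29 / 32 : ℝ) ≤ forrelation f g) :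
    forrelation f g = 29 / 32 ∧
    ∃ uf : (Fin (6 + 6) → Bool) → ℤ, (∀ y, W (fun x => signOf (f x)) y = (2 : ℝ) ^ 4 * (uf y : ℝ)) ∧ (∀ y, ¬ Odd (uf y)) ∧
      (∀ y, ¬ Odd (uf y / 2)) ∧
    ∃ v : (Fin (6 + 6) → Bool) → ℤ,
      (∀ x, u x - 4 * sZ (f x) =
        sZ (decide (Odd (u x / 2))) * (1 - 4 * (if (Odd (u x / 2) ↔ Odd (u x / 2 / 2)) then 1 else 0)) + 8 * v x) ∧
      ∑ x, v x ^ 2 = 32 ∧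
      ∃ k : (Fin (6 + 6) → Bool) → ℤ, (∀ y, ∑ x, (v x : ℝ) * twist x y = 8 * (k y : ℝ)) ∧ (∀ y, (4 : ℤ) ∣ k y + uf y) ∧
        (∀ y, k y = 0 ∨ k y = 4 ∨ k y = -4) ∧ #(univ.filter fun y : Fin (6 + 6) → Bool => k y ≠ 0) = 128 := by
  classical
  have hΦ' : forrelation g f = forrelation f g := by
    rw [Summit.QuantumAdvantage.QuantumAdvantage.Theorems.SignedCubicForrelationNotPrBPP.Negative.HalfQuad.forrelation_comm]
  have hall : ∀ x, Odd (u x) := TypeOTwelve.typeO_of_exists_odd g u hg hu hodd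
  have hu' : ∀ x, W (fun y => signOf (g y)) x = (2 : ℝ) ^ (2 * 2) * (u x : ℝ) := fun x => (hu x).trans (by norm_num)
  have hd1 : IsDegLeFun 1 (fun x => decide (Odd (u x / 2))) := z2_digitOne 2 g u hg hu' hall
  have hd2 : IsDegLeFun 3 (fun x => decide (Odd (u x / 2 / 2))) := z2_digitTwo 2 g u hg hu' hall
  obtain ⟨c₁, b₁, hcb⟩ := stub_affineForm (6 + 6) _ hd1
  set E := univ.filter (fun x : Fin (6 + 6) → Bool => (Odd (u x / 2) ↔ Odd (u x / 2 / 2))) with hEdef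
  have hdegE : IsDegLeFun (2 + 1) (fun x => (decide (Odd (u x / 2)) ^^ decide (Odd (u x / 2 / 2))) ^^ true) :=
    tb_isDegLeFun_xor_const (bb_isDegLeFun_bxor (hd1.mono (by norm_num)) hd2) true
  have hsetE : (univ.filter fun x : Fin (6 + 6) → Bool =>
      ((decide (Odd (u x / 2)) ^^ decide (Odd (u x / 2 / 2))) ^^ true) = true) = E := by
    rw [hEdef]
    apply filter_congr
    intro x _
    by_cases h1 : Odd (u x / 2) <;> by_cases h2 : Odd (u x / 2 / 2) <;> simp [h1, h2]
  -- not at `Φ ≥ 930/1024`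
  have hlt930 : forrelation f g < 930 / 1024 := by
    by_contra h; push Not at h
    exact to19_typeO_E960_ge930_false' f g hf hg u hu hodd hE h
  -- budget: `Σ τ² = 2¹⁷(1 − Φ) ≤ 12288`
  obtain ⟨-, -, hT, hbud⟩ := to21_typeO_ge2932_shape f g hg u hu hodd hΦ
  -- wild decomposition `τ = τ₀ + 8v`
  choose v hv using fun x => to12_pt_mod8 (u x) (sZ (f x)) (hall x) (tp_sZ_cases (f x))
  set τ₀ : (Fin (6 + 6) → Bool) → ℤ := fun x =>
    sZ (decide (Odd (u x / 2))) * (1 - 4 * (if (Odd (u x / 2) ↔ Odd (u x / 2 / 2)) then 1 else 0)) with hτ₀def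
  have hτ₀val : ∀ x, τ₀ x = 1 ∨ τ₀ x = -1 ∨ τ₀ x = 3 ∨ τ₀ x = -3 := by
    intro x
    simp only [τ₀]
    rcases tp_sZ_cases (decide (Odd (u x / 2))) with h | h <;> rw [h] <;> split_ifs <;> norm_num
  have hτ₀sq : ∀ x, τ₀ x ^ 2 = 1 + 8 * (if (Odd (u x / 2) ↔ Odd (u x / 2 / 2)) then 1 else 0 : ℤ) := by
    intro x
    simp only [τ₀]
    rcases tp_sZ_cases (decide (Odd (u x / 2))) with h | h <;> rw [h] <;> split_ifs <;> norm_num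
  have hsumE : (∑ x, (if (Odd (u x / 2) ↔ Odd (u x / 2 / 2)) then 1 else 0 : ℤ)) = #E := by rw [sum_boole]
  have hsumτ₀ : ∑ x, τ₀ x ^ 2 = 11776 := by
    rw [sum_congr rfl fun x _ => hτ₀sq x, sum_add_distrib, ← mul_sum, hsumE, sum_const, card_univ, Fintype.card_fun,
      Fintype.card_bool, Fintype.card_fin, hE]
    norm_num
  have hX16 : ∀ x, 16 * v x ^ 2 ≤ (τ₀ x + 8 * v x) ^ 2 - τ₀ x ^ 2 := by
    intro x
    have ht : -3 ≤ τ₀ x ∧ τ₀ x ≤ 3 := by rcases hτ₀val x with h | h | h | h <;> rw [h] <;> norm_num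
    have key : 0 ≤ v x * (3 * v x + τ₀ x) := by
      rcases lt_trichotomy (v x) 0 with hlt | heq | hgt
      · have h1 : 3 * v x + τ₀ x ≤ 0 := by linarith
        nlinarith
      · rw [heq]; simp
      · have h1 : 0 ≤ 3 * v x + τ₀ x := by linarith
        exact mul_nonneg hgt.le h1
    nlinarith [key]
  have hTdec : (∑ x, (u x - 4 * sZ (f x)) ^ 2 : ℤ) = ∑ x, τ₀ x ^ 2 + ∑ x, ((τ₀ x + 8 * v x) ^ 2 - τ₀ x ^ 2) := by
    rw [← sum_add_distrib]; exact sum_congr rfl fun x _ => by rw [hv x]; ring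
  have hXV : 16 * ∑ x, v x ^ 2 ≤ ∑ x, ((τ₀ x + 8 * v x) ^ 2 - τ₀ x ^ 2) := by
    rw [mul_sum]; exact sum_le_sum fun x _ => hX16 x
  have hV : ∑ x, v x ^ 2 ≤ 32 := by
    have h2 : 16 * ∑ x, v x ^ 2 ≤ 512 := by linarith
    omega
  -- the partner and the wild identity
  obtain ⟨uf, huf⟩ := tw_base (n := 6 + 6) f hf 4 (by norm_num)
  have hid : ∀ y, 64 * (uf y : ℝ) = 256 * signOf (g y) -
      signOf b₁ * ((if bxor c₁ y = (fun _ => false) then (2 : ℝ) ^ (6 + 6) else 0) - 4 * ∑ x ∈ E, twist x (bxor c₁ y)) -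
      8 * ∑ x, (v x : ℝ) * twist x y := by
    intro y
    have h := to18_typeO_partner_identity f g u hu v hv c₁ b₁ hcb uf huf y
    rw [← hEdef] at h
    exact h
  have hsb : ((sZ b₁ : ℤ) : ℝ) = signOf b₁ := tp_sZ_cast _
  -- `v̂ = 8k` with `4 ∣ k + u_f`
  have hk : ∀ y, ∃ k : ℤ, (∑ x, (v x : ℝ) * twist x y) = 8 * (k : ℝ) ∧ (4 : ℤ) ∣ k + uf y := by
    intro y
    obtain ⟨m', -, hm'⟩ := to18_char_sum_E960 _ hdegE (by rw [hsetE]; exact hE) (bxor c₁ y)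
    rw [hsetE] at hm'
    have h := hid y
    rw [hm'] at h
    by_cases hz : bxor c₁ y = (fun _ => false)
    · rw [if_pos hz] at h
      refine ⟨4 * sZ (g y) - 64 * sZ b₁ + 4 * sZ b₁ * m' - uf y, ?_, ⟨sZ (g y) - 16 * sZ b₁ + sZ b₁ * m', by ring⟩⟩
      push_cast; rw [tp_sZ_cast, hsb]
      have e4096 : (2 : ℝ) ^ (6 + 6) = 4096 := by norm_num
      rw [e4096] at h
      linarith
    · rw [if_neg hz] at h
      refine ⟨4 * sZ (g y) + 4 * sZ b₁ * m' - uf y, ?_, ⟨sZ (g y) + sZ b₁ * m', by ring⟩⟩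
      push_cast; rw [tp_sZ_cast, hsb]
      linarith
  choose k hk8 hk4 using hk
  -- the hyperplane count of the partner at `Φ ≥ 29/32`
  have hS : (∀ y, ¬ Odd (uf y)) → (∃ y, Odd (uf y / 2)) → 2048 ≤ #(univ.filter fun y : Fin (6 + 6) → Bool => Odd (uf y / 2)) := by
    intro hO hO5
    have huf5 := tw_level_up (j := 4) f uf huf hO
    rw [tw22_oddset_card_ge2932 g f hf (fun y => uf y / 2) huf5 hO5 (by rw [hΦ']; exact hΦ)]
  rcases to22_wild_engine32_dichotomy f hf uf huf hS v hV k hk8 hk4 with hv0 | ⟨hO, hO5, hVeq, hkval, hcard⟩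
  · -- `v ≡ 0`: zero excess, `Φ = 932/1024` — but `Φ < 930/1024`
    exfalso
    have hTeq : (∑ x, (u x - 4 * sZ (f x)) ^ 2 : ℤ) = 11776 := by
      rw [← hsumτ₀]; exact sum_congr rfl fun x _ => by rw [hv x, hv0 x]; ring
    have h : ((∑ x, (u x - 4 * sZ (f x)) ^ 2 : ℤ) : ℝ) = 11776 := by exact_mod_cast hTeq
    rw [hbud] at h
    linarith
  · -- thirty-two aligned wild points: the budget is exhausted, `Φ = 29/32`
    have h1 := hXV
    rw [hVeq] at h1
    have hTge : (12288 : ℤ) ≤ ∑ x, (u x - 4 * sZ (f x)) ^ 2 := by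
      rw [hTdec, hsumτ₀]
      linarith
    have hTeq : (∑ x, (u x - 4 * sZ (f x)) ^ 2 : ℤ) = 12288 := le_antisymm hT hTge
    have hΦeq : forrelation f g = 29 / 32 := by
      have h : ((∑ x, (u x - 4 * sZ (f x)) ^ 2 : ℤ) : ℝ) = 12288 := by exact_mod_cast hTeq
      rw [hbud] at h
      linarith
    exact ⟨hΦeq, uf, huf, hO, hO5, v, hv, hVeq, k, hk8, hk4, hkval, hcard⟩

/-- **No type-O × type-O pair with a type-O base set of `960` points at `Φ ≥ 29/32`** (12 bits).  NOT summit progress. [this work] -/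
theorem to22_typeO_E960_typeO_partner_false (f g : (Fin (6 + 6) → Bool) → Bool) (hf : IsDegLeFun 3 f) (hg : IsDegLeFun 3 g)
    (u : (Fin (6 + 6) → Bool) → ℤ) (hu : ∀ x, W (fun y => signOf (g y)) x = (2 : ℝ) ^ 4 * (u x : ℝ))
    (hodd : ∃ x, Odd (u x)) (hE : #(univ.filter fun x : Fin (6 + 6) → Bool => (Odd (u x / 2) ↔ Odd (u x / 2 / 2))) = 960)
    (uf : (Fin (6 + 6) → Bool) → ℤ) (huf : ∀ y, W (fun x => signOf (f x)) y = (2 : ℝ) ^ 4 * (uf y : ℝ)) (hoddf : ∃ y, Odd (uf y))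
    (hΦ : (29 / 32 : ℝ) ≤ forrelation f g) : False := by
  obtain ⟨-, uf', huf', hO, -⟩ := to22_typeO_E960_ge2932_dichotomy f g hf hg u hu hodd hE hΦ
  obtain ⟨y, hy⟩ := hoddf
  have heq : uf y = uf' y := by
    have h := (huf y).symm.trans (huf' y)
    have h' : ((uf y : ℤ) : ℝ) = ((uf' y : ℤ) : ℝ) := by
      have h2 : (2 : ℝ) ^ 4 ≠ 0 := by norm_num
      exact mul_left_cancel₀ h2 h
    exact_mod_cast h'
  exact hO y (heq ▸ hy)

/-- **No type-O × level-5 pair with a type-O base set of `960` points at `Φ ≥ 29/32`** (12 bits): `W_g = 16u` with some `u` odd and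
`#E = 960`, `W_f = 32u'_f` with some `u'_f` odd, `Φ(f,g) ≥ 29/32` is impossible.  NOT summit progress. [this work] -/
theorem to22_typeO_E960_levelFive_partner_false (f g : (Fin (6 + 6) → Bool) → Bool) (hf : IsDegLeFun 3 f) (hg : IsDegLeFun 3 g)
    (u : (Fin (6 + 6) → Bool) → ℤ) (hu : ∀ x, W (fun y => signOf (g y)) x = (2 : ℝ) ^ 4 * (u x : ℝ))
    (hodd : ∃ x, Odd (u x)) (hE : #(univ.filter fun x : Fin (6 + 6) → Bool => (Odd (u x / 2) ↔ Odd (u x / 2 / 2))) = 960)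
    (uf' : (Fin (6 + 6) → Bool) → ℤ) (huf' : ∀ y, W (fun x => signOf (f x)) y = (2 : ℝ) ^ 5 * (uf' y : ℝ)) (hoddf : ∃ y, Odd (uf' y))
    (hΦ : (29 / 32 : ℝ) ≤ forrelation f g) : False := by
  obtain ⟨-, uf, huf, -, hO5, -⟩ := to22_typeO_E960_ge2932_dichotomy f g hf hg u hu hodd hE hΦ
  obtain ⟨y, hy⟩ := hoddf
  have heq : uf y = 2 * uf' y := by
    have h := (huf y).symm.trans (huf' y)
    have h' : ((uf y : ℤ) : ℝ) = ((2 * uf' y : ℤ) : ℝ) := by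
      have h2 : (2 : ℝ) ^ 4 ≠ 0 := by norm_num
      push_cast
      have : (2 : ℝ) ^ 4 * (uf y : ℝ) = (2 : ℝ) ^ 4 * (2 * (uf' y : ℝ)) := by rw [h]; ring
      exact mul_left_cancel₀ h2 this
    exact_mod_cast h'
  apply hO5 y
  rw [heq, Int.mul_ediv_cancel_left _ two_ne_zero]
  exact hy

end Summit.QuantumAdvantage.QuantumAdvantage.Theorems.CubicForrelation.NearExactIsExact

end
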